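import Mathlib
import HarnessLib
import Summits.HubbardSuperconductivity.HubbardSuperconductivity.Theorems.KLProgrammePerturbedFermiCurveCooperSlope
import Summits.HubbardSuperconductivity.HubbardSuperconductivity.Theorems.KLProgrammePerturbedFermiCurveFrameHessBridge

/-!
# Route `KLProgramme` — ENGINE child (stmt-HubbardSuperconductivity-20437 `KLRegimeEngineV17F2`): a NEAR-TANGENT point of the translated frame curve is
# ODD-ALIGNED (near the caustic) once the transfer is away from `2πℤ²` (step (T2)-caustic; design note HOME/hubbard-kl-k3c2-p2/TWO-SHELL-FRAME-PORT.md §6–§8)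

Cell `gate-hubbard-kl`, seat hubbard-kl-k3c2-p2 g15.  Frame twin of p1b's `klsg_nearTangent_near_caustic` / `klsd_bad_point_near_caustic`: the transversality
alternative `transversality_alternative_of_geomConstants` at the reduced point `k ≡ p(t) − v (mod 2πℤ²)` with the COOPER branch excluded by the torus
distance of the transfer `v` to `2πℤ²`:
* **`nearTangent_near_caustic_of_geomConstants`** — if `|E(p(t) − v) − ν| ≤ η`, the slope `|G′(t)| ≤ λ` (coordinate form of `hasDerivAt_transLevel`), `v` is NOT
  `R₀`-close to `2πℤ²` and `R(λ, η) ≤ R₀`, then `2p(t) − v` is `R(λ, η)`-close (sup-norm) to some `2πm`;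
* **`nearTangent_near_caustic_momentum`** — the same with the slope in `Momentum` form `De_K(toLp(p(t) − v))[toLp(X_E′, Y_E′)]` (`fderiv_frameLevel_toLp`).
Everything is PROVED; no definitions, no named facts; nothing asserts any stub or superconductivity.
References: DECOMP App. E Lemma E.3; FST II App. B [cite: FeldmanSalmhoferTrubowitz1998]; BGM 2006 §2.7 [cite: BenfattoGiulianiMastropietro2006].
-/

noncomputable section

namespace Summit.HubbardSuperconductivity.HubbardSuperconductivity.Theorems.PerturbedFermiCurve

set_option linter.dupNamespace false -- summit = problem name (single-conjunct summit), D-0017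

open Real Set
open Literature.MathematicalPhysics.QuantumLattice Literature.MathematicalPhysics.QuantumLattice.BandSectorCounting
open Literature.MathematicalPhysics.QuantumLattice.FermiRG
open Summit.HubbardSuperconductivity.HubbardSuperconductivity.Theorems.DispersionFlow
open Summit.HubbardSuperconductivity.HubbardSuperconductivity.Theorems.KLRegimeSplit

section Frame

variable {a b : ℝ} (B : BandBounds a b) {K : TrigPolyC4v} {κ₀ κ₁ : ℝ}
  (hδ : ∀ k : Fin 2 → ℝ, (∀ i, |k i| ≤ π) → |(fun k : Fin 2 → ℝ => -K.eval k) k| ≤ κ₀)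
  (hκ : ∀ k : Fin 2 → ℝ, (∀ i, |k i| ≤ π) → ‖fderiv ℝ (fun k : Fin 2 → ℝ => -K.eval k) k‖ ≤ κ₁) (hκ₁ : κ₁ < B.Dtmin)
  {μ Kc r₀ g₀ w : ℝ} (hG : GeomConstants (frameLevel μ K) Kc r₀ g₀ w) {ν : ℝ} (hν : |ν - μ| < r₀)
include B hδ hκ hκ₁ hG hν

/-- **A near-tangent point is odd-aligned.**  `p = perturbedFermiRadius δ_K ν·dir`; if at the angle `t` the translate is on the `η`-shell (`|E(p(t) − v) − ν| ≤ η`),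
the slope is `≤ λ`, the levels `ν ± (κ₀ + η)` are admissible, `v` is NOT `R₀`-close to `2πℤ²` and `R(λ, η) ≤ R₀`, then `2p(t) − v` is within `R(λ, η)` of
`2πm` for some `m ∈ ℤ²` (sup-norm), `R(λ, η) = (η + s_max Dt_min τ)/(Dt_min − κ₁)`, `τ = ((π/2)λ/((Dt_min − κ₁)u_min) + πKc η/(Dt_min − κ₁)²)(4 + κ₁)/(u_min w)`.
[cite: FeldmanSalmhoferTrubowitz1998, App. B] -/
theorem nearTangent_near_caustic_of_geomConstants {v : Fin 2 → ℝ} {η lam R₀ : ℝ} (t : ℝ)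
    (hlev : |sqDispersion (perturbedFermiRadius (fun k : Fin 2 → ℝ => -K.eval k) ν t • dir t - v) +
        -K.eval (perturbedFermiRadius (fun k : Fin 2 → ℝ => -K.eval k) ν t • dir t - v) - ν| ≤ η)
    (hslope : |2 * Real.sin ((perturbedFermiRadius (fun k : Fin 2 → ℝ => -K.eval k) ν t • dir t - v) 0) *
          VXE (perturbedFermiRadius (fun k : Fin 2 → ℝ => -K.eval k) ν) t +
        2 * Real.sin ((perturbedFermiRadius (fun k : Fin 2 → ℝ => -K.eval k) ν t • dir t - v) 1) *
          VYE (perturbedFermiRadius (fun k : Fin 2 → ℝ => -K.eval k) ν) t +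
        fderiv ℝ (fun k : Fin 2 → ℝ => -K.eval k) (perturbedFermiRadius (fun k : Fin 2 → ℝ => -K.eval k) ν t • dir t - v)
          ![VXE (perturbedFermiRadius (fun k : Fin 2 → ℝ => -K.eval k) ν) t, VYE (perturbedFermiRadius (fun k : Fin 2 → ℝ => -K.eval k) ν) t]| ≤ lam)
    (hlo : a ≤ ν - κ₀ - η) (hhi : ν + κ₀ + η ≤ b)
    (hfar : ∀ m : Fin 2 → ℤ, ∃ i, R₀ < |v i + m i * (2 * π)|)
    (hR : (η + B.smax * B.Dtmin *
        ((π / 2 * lam / ((B.Dtmin - κ₁) * B.umin) + π * Kc * η / (B.Dtmin - κ₁) ^ 2) * (4 + κ₁) / (B.umin * w))) / (B.Dtmin - κ₁) ≤ R₀) :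
    ∃ m : Fin 2 → ℤ, ∀ i, |2 * (perturbedFermiRadius (fun k : Fin 2 → ℝ => -K.eval k) ν t • dir t) i - v i - m i * (2 * π)| ≤
      (η + B.smax * B.Dtmin *
        ((π / 2 * lam / ((B.Dtmin - κ₁) * B.umin) + π * Kc * η / (B.Dtmin - κ₁) ^ 2) * (4 + κ₁) / (B.umin * w))) / (B.Dtmin - κ₁) := by
  set δ : (Fin 2 → ℝ) → ℝ := fun k : Fin 2 → ℝ => -K.eval k with hδdef
  set u := perturbedFermiRadius δ ν with hudef
  set p : Fin 2 → ℝ := u t • dir t with hp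
  set q : Fin 2 → ℝ := p - v with hq
  set V : Fin 2 → ℝ := ![VXE u t, VYE u t] with hV
  -- reduce `q` to the closed square
  obtain ⟨m, hm⟩ := exists_sub_int_mul_mem_square q
  set k : Fin 2 → ℝ := fun i => q i - m i * (2 * π) with hk
  have hEk : sqDispersion k + -K.eval k = sqDispersion q + -K.eval q := transLevel_sub_int_mul_eq K q m
  have hℓk : 2 * Real.sin (k 0) * V 0 + 2 * Real.sin (k 1) * V 1 + fderiv ℝ δ k V =
      2 * Real.sin (q 0) * V 0 + 2 * Real.sin (q 1) * V 1 + fderiv ℝ δ q V := slopeForm_sub_int_mul_eq K q V m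
  have hV0 : V 0 = VXE u t := by simp [hV]
  have hV1 : V 1 = VYE u t := by simp [hV]
  have hsq : ∀ i, |k i| ≤ π := hm
  have hκ₁0 : 0 ≤ κ₁ := le_trans (norm_nonneg _) (hκ k hsq)
  have hD : 0 < B.Dtmin - κ₁ := sub_pos.2 hκ₁
  have hum := B.umin_pos
  have hw := hG.wmin_pos
  have hsm := B.smax_pos
  have hDt := B.Dtmin_pos
  have hKc : 0 ≤ Kc := le_trans (norm_nonneg _) (hG.norm_iteratedFDeriv_le (WithLp.toLp 2 k) 0 (by norm_num))
  have hη : 0 ≤ η := (abs_nonneg _).trans hlev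
  -- the slope at the reduced point is `≤ λ`
  have hℓ : |2 * Real.sin (k 0) * VXE u t + 2 * Real.sin (k 1) * VYE u t + fderiv ℝ δ k ![VXE u t, VYE u t]| ≤ lam := by
    have e := hℓk
    rw [hV0, hV1] at e
    rw [e]; exact hslope
  -- the alternative at `k`
  have hshell : |sqDispersion k + -K.eval k - ν| ≤ η := by rw [hEk]; exact hlev
  have halt := transversality_alternative_of_geomConstants B hδ hκ hκ₁ hG hν hsq hshell hlo hhi t
  -- the radius there is `≤ R(λ, η)` (monotone in the slope)
  set τk := (π / 2 * |2 * Real.sin (k 0) * VXE u t + 2 * Real.sin (k 1) * VYE u t + fderiv ℝ δ k ![VXE u t, VYE u t]| /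
      ((B.Dtmin - κ₁) * B.umin) + π * Kc * η / (B.Dtmin - κ₁) ^ 2) * (4 + κ₁) / (B.umin * w) with hτk
  set τ0 := (π / 2 * lam / ((B.Dtmin - κ₁) * B.umin) + π * Kc * η / (B.Dtmin - κ₁) ^ 2) * (4 + κ₁) / (B.umin * w) with hτ0
  have hτ : τk ≤ τ0 := by
    rw [hτk, hτ0]
    refine div_le_div_of_nonneg_right (mul_le_mul_of_nonneg_right ?_ (by linarith)) (by positivity)
    have := div_le_div_of_nonneg_right (mul_le_mul_of_nonneg_left hℓ (by positivity : (0:ℝ) ≤ π / 2)) (le_of_lt (mul_pos hD hum))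
    linarith
  have hRk : (η + B.smax * B.Dtmin * τk) / (B.Dtmin - κ₁) ≤ (η + B.smax * B.Dtmin * τ0) / (B.Dtmin - κ₁) := by
    refine div_le_div_of_nonneg_right ?_ hD.le
    have := mul_le_mul_of_nonneg_left hτ (mul_pos hsm hDt).le
    linarith
  have hpπ : u (t + π) • dir (t + π) = -p := by
    have heven : ∀ x : Fin 2 → ℝ, δ (-x) = δ x := fun x => by simp [hδdef, TrigPolyC4v.eval_neg]
    rw [hp, hudef]; exact perturbed_point_add_pi heven ν t
  rcases halt with hC | hS
  · -- Cooper branch contradicts `hfar`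
    exfalso
    obtain ⟨i, hi⟩ := hfar m
    have h1 := ((hC i).trans hRk).trans hR
    have e : k i - p i = -(v i + m i * (2 * π)) := by
      simp only [hk, hq, Pi.sub_apply]; ring
    rw [e, abs_neg] at h1
    exact absurd h1 (not_le.2 hi)
  · -- caustic branch: `2p(t) − v` is near `2πm`
    refine ⟨m, fun i => ?_⟩
    have h1 := (hS i).trans hRk
    rw [hpπ] at h1
    have e : k i - (-p) i = 2 * p i - v i - m i * (2 * π) := by
      simp only [hk, hq, Pi.sub_apply, Pi.neg_apply]; ring
    rw [e] at h1
    exact h1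

/-- **The same with the slope in `Momentum` form** `G′(t) = De_K(toLp(p(t) − v))[toLp(X_E′, Y_E′)]` (`hasDerivAt_frameLevel_transCurve`). [cite: FeldmanSalmhoferTrubowitz1998, App. B] -/
theorem nearTangent_near_caustic_momentum {v : Fin 2 → ℝ} {η lam R₀ : ℝ} (t : ℝ)
    (hlev : |sqDispersion (perturbedFermiRadius (fun k : Fin 2 → ℝ => -K.eval k) ν t • dir t - v) +
        -K.eval (perturbedFermiRadius (fun k : Fin 2 → ℝ => -K.eval k) ν t • dir t - v) - ν| ≤ η)
    (hslope : |fderiv ℝ (frameLevel μ K) (WithLp.toLp 2 (perturbedFermiRadius (fun k : Fin 2 → ℝ => -K.eval k) ν t • dir t - v))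
        (WithLp.toLp 2 ![VXE (perturbedFermiRadius (fun k : Fin 2 → ℝ => -K.eval k) ν) t,
          VYE (perturbedFermiRadius (fun k : Fin 2 → ℝ => -K.eval k) ν) t])| ≤ lam)
    (hlo : a ≤ ν - κ₀ - η) (hhi : ν + κ₀ + η ≤ b)
    (hfar : ∀ m : Fin 2 → ℤ, ∃ i, R₀ < |v i + m i * (2 * π)|)
    (hR : (η + B.smax * B.Dtmin *
        ((π / 2 * lam / ((B.Dtmin - κ₁) * B.umin) + π * Kc * η / (B.Dtmin - κ₁) ^ 2) * (4 + κ₁) / (B.umin * w))) / (B.Dtmin - κ₁) ≤ R₀) :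
    ∃ m : Fin 2 → ℤ, ∀ i, |2 * (perturbedFermiRadius (fun k : Fin 2 → ℝ => -K.eval k) ν t • dir t) i - v i - m i * (2 * π)| ≤
      (η + B.smax * B.Dtmin *
        ((π / 2 * lam / ((B.Dtmin - κ₁) * B.umin) + π * Kc * η / (B.Dtmin - κ₁) ^ 2) * (4 + κ₁) / (B.umin * w))) / (B.Dtmin - κ₁) := by
  set u := perturbedFermiRadius (fun k : Fin 2 → ℝ => -K.eval k) ν with hudef
  have h := fderiv_frameLevel_toLp μ K (u t • dir t - v) ![VXE u t, VYE u t]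
  simp only [Matrix.cons_val_zero, Matrix.cons_val_one] at h
  rw [h] at hslope
  exact nearTangent_near_caustic_of_geomConstants B hδ hκ hκ₁ hG hν t hlev hslope hlo hhi hfar hR

end Frame

end Summit.HubbardSuperconductivity.HubbardSuperconductivity.Theorems.PerturbedFermiCurve

end
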